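import Literature.AnabelianGeometry.SemiGraphs.TemperedVerticialMaximalCompactOfFrattini
import HarnessLib

/-!
# [SemiAnbd] Thm 3.7 (iv), the half «verticial ⇒ maximal compact», at EVERY vertex of EVERY countable graph of
# the Thm-3.7 class — from TOTAL ELEVATION alone (proof-only)

Mochizuki, *Semi-graphs of anabelioids*, Publ. RIMS **42** (2006), §3, Theorem 3.7 (iv) p. 41 ("the maximal
compact subgroups of `π₁^temp(𝒢)` are precisely the verticial subgroups of `π₁^temp(𝒢)`") and Def. 2.4 (i) p. 25
(a vertex `v` is *elevated*: for every `M` some `π₁`-epimorphic approximator `𝒢 → 𝒢'` has a subgroup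
`N ≤ π₁(𝒢'_v)` of order `≥ M` meeting EVERY conjugate of the image of EVERY branch group at `v` trivially)
[cite: MochizukiSemiAnbd2006, Thm 3.7(iv) p.41].

PROOF-ONLY file (abc-iut cell, layer L3, seat abc-iut-w6-d064 gen 8, row «T37iv-VERT⇒MAXCPT@ALL»; no definition, no
named fact).  The tree proved the half «every verticial subgroup of `π₁^temp(𝒢)` is a MAXIMAL compact subgroup» of
Thm. 3.7 (iv) on classes: locally finite graphs (abc-iut-w6-d062, -d063), topologically cyclic edge groups (this
seat, gen 7), the one-level NOFIX / stabiliser-level criteria and the pro-`p` («Frattini») vertex class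
(abc-iut-L3-t6, gens 9–10), finite valence and the union class (this seat, `TemperedVerticialMaximalCompactOfFrattini`).
THIS FILE REMOVES EVERY CLASS HYPOTHESIS:

* `isMaximalCompactSubgroup_of_exists_mem_verticialSubgroups` / `eq_of_verticial_le_compact` — **for every countable `𝒢`
  satisfying the hypotheses of
  Thm. 3.7 ([SemiAnbd] p. 40: connected, countable, quasi-coherent, totally elevated, totally estranged, verticially
  slim — the cell's `Thm37Hypotheses`), every chart and every vertex `v`, EVERY VERTICIAL SUBGROUP OF `π₁^temp(𝒢)`
  IS A MAXIMAL COMPACT SUBGROUP** — arbitrary valence, arbitrary vertex and edge groups, arbitrary underlying graph.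

THE POINT.  By this seat's engine `exists_level_forall_branchSubgroup_mul_ker_of_range_decompHom_lt` (p513113) a
compact `K ⊋ δ_P(Π_v)` forces, at every large level `m`, a branch `b_m` AT `v` with `Π_v = Π_{b_m} · N_m`
(`N_m = ker (h ↦ σ_m^h)`, decreasing to `1` by Thm. 3.7 (i)).  Total elevation AS TYPED (`IsElevatedVertex`, with
`M = 2`) provides ONE `π₁`-epimorphic approximator `A` and `N ≤ F_v := A.FV v`, `|N| ≥ 2`, with
`N ⊓ g · brF_b(F_e) · g⁻¹ = ⊥` for ALL branches `b` at `v` and all `g` SIMULTANEOUSLY.  The kernel `U` of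
`Π_v → F_v` is open, so `N_m ⊆ U` for some large `m` (compactness, `pointSeq_exists_level_forall_gal_eq_one_mem`);
then `Π_v = Π_{b_m} · N_m` maps onto `F_v = πV(Π_{b_m})`, which by the 2-cell `A.comm` lies in a conjugate of
`brF_{b_m}(F_e)`: that conjugate is ALL of `F_v`, hence `N = ⊥` — contradiction.  (The same use of Def. 2.4 (i) as
abc-iut-L3's `branchSubgroup_ne_top`, applied to the image in `F_v`; the uniformity in `b` of the typed elevation is
exactly what the varying-branch escape of an infinite-valence vertex cannot survive.)

Honest framing: OUR typed `π₁^temp` and OUR typing of Def. 2.4 (i); the other half of the first sentence of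
Thm. 3.7 (iv) («maximal compact ⇒ verticial») is NOT touched — it is refuted as typed at `𝒢_θ` (abc-iut-w4-d011
p443103) and at the rayless star `𝒢⋆(p)` (abc-iut-L3-t8); nothing here bears on [IUTchIII] Cor. 3.12; typed ≠ proved.
-/

namespace Literature.AnabelianGeometry.SemiGraphs

namespace ProfiniteSemiGraph

open CategoryTheory Topology
open Literature.GroupTheory.CompactGroupIntersections (exists_mem_forall_of_antitone)

universe u

variable (𝒢 : ProfiniteSemiGraph.{u})

/-! ### Some level kernel lies inside any given open subgroup of `Π_v` -/

/-- **Level-kernel cofinality along a point sequence**: for every open subgroup `U ≤ Π_v` and every `n₀`, at some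
level `m ≥ n₀` the kernel `N_m = {k | σ_m^k = 1}` lies in `U` (the closed sets `N_m ∖ U` decrease in `m` and have
empty intersection, `⋂_m N_m = 1` being Thm. 3.7 (i); compactness of `Π_v`).
[cite: MochizukiSemiAnbd2006, Thm 3.7(i) p.40] -/
theorem pointSeq_exists_level_forall_gal_eq_one_mem (h37 : 𝒢.Thm37Hypotheses) {v : 𝒢.graph.Vertex}
    (P : (𝒢.galoisLevelData h37.toProp36Hypotheses).PointSeq h37.isCountable v)
    (U : Subgroup (𝒢.Gv v)) (hU : IsOpen (U : Set (𝒢.Gv v))) (n₀ : ℕ) :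
    ∃ m, n₀ ≤ m ∧ ∀ k : 𝒢.Gv v, P.gal m k = 1 → k ∈ U := by
  by_contra hcon
  push Not at hcon
  obtain ⟨k, hk⟩ := exists_mem_forall_of_antitone
    (fun i : ℕ => {k : 𝒢.Gv v | P.gal (max i n₀) k = 1} ∩ (U : Set (𝒢.Gv v))ᶜ)
    (fun i j hij x hx =>
      ⟨𝒢.pointSeq_gal_eq_one_of_le h37.toProp36Hypotheses P (max_le_max hij le_rfl) x hx.1, hx.2⟩)
    (fun i => by
      obtain ⟨k, hk1, hkU⟩ := hcon (max i n₀) (le_max_right i n₀)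
      exact ⟨k, hk1, hkU⟩)
    (fun i => (P.isClosed_setOf_gal_eq (max i n₀) 1).inter hU.isClosed_compl)
  have hk1 : k = 1 := 𝒢.pointSeq_eq_one_of_forall_gal_eq_one h37 P k fun n =>
    𝒢.pointSeq_gal_eq_one_of_le h37.toProp36Hypotheses P (le_max_left n n₀) k (hk n).1
  exact (hk 0).2 (hk1 ▸ U.one_mem)

/-! ### Total elevation forbids `Π_v = Π_b · U` for an open `U` inside an elevation kernel -/

/-- **No branch group supplements the kernel of an elevation approximator**: if `A` is a `π₁`-epimorphic
approximator carrying a nontrivial `N ≤ F_v` that meets every conjugate of every `brF_b(F_e)` (`b` at `v`)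
trivially — Def. 2.4 (i) with `M = 2` — then for NO branch `b` at `v` is `Π_v = Π_b · ker(Π_v → F_v)`: otherwise
`πV(Π_b) = F_v` lies in a conjugate of `brF_b(F_e)` (`A.comm`), forcing `N = ⊥`.
[cite: MochizukiSemiAnbd2006, Def 2.4(i) p.25] -/
theorem not_forall_exists_branchSubgroup_mul_ker_of_elevated {v : 𝒢.graph.Vertex} (A : 𝒢.Approximator)
    (hA : A.IsPiOneEpimorphic) (N : Subgroup (A.FV v)) (hN2 : 2 ≤ Nat.card N)
    (hN : ∀ (b : 𝒢.graph.Branch) (h : 𝒢.graph.abuts b = some v) (g : A.FV v),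
      N ⊓ ((A.brF b v h).range.map (MulAut.conj g).toMonoidHom) = ⊥)
    (b : 𝒢.graph.Branch) (hb : 𝒢.graph.abuts b = some v)
    (hsup : ∀ x : 𝒢.Gv v, ∃ a ∈ 𝒢.branchSubgroup b v hb, a⁻¹ * x ∈ (A.πV v).ker) : False := by
  obtain ⟨g, hg⟩ := A.comm b v hb
  -- the conjugate `g⁻¹ · brF_b(F_e) · g` is all of `F_v`
  have hfull : ((A.brF b v hb).range.map (MulAut.conj g⁻¹).toMonoidHom) = ⊤ := by
    rw [eq_top_iff]
    intro y _
    obtain ⟨x, rfl⟩ := hA.1 v y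
    obtain ⟨a, ⟨t, rfl⟩, hax⟩ := hsup x
    -- `πV x = πV (b_*(t))`
    have hπ : A.πV v x = A.πV v (𝒢.brHom b v hb t) := by
      have h1 : A.πV v ((𝒢.brHom b v hb t)⁻¹ * x) = 1 := hax
      rw [map_mul, map_inv, inv_mul_eq_one] at h1
      exact h1.symm
    refine ⟨A.brF b v hb (A.πE _ t), ⟨_, rfl⟩, ?_⟩
    simp only [MulEquiv.coe_toMonoidHom, MulAut.conj_apply, inv_inv, hg t, hπ]
    group
  have h1 := hN b hb g⁻¹
  rw [hfull, inf_top_eq] at h1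
  -- `N = ⊥` has one element, not `≥ 2`
  rw [h1, Subgroup.card_bot] at hN2
  omega

/-! ### Verticial ⇒ maximal compact, unconditionally on the Thm-3.7 class -/

/-- **At the canonical chart: `δ_P(Π_v)` is a MAXIMAL compact subgroup of `π₁^temp(𝒢)`** — every countable `𝒢`
under the hypotheses of Thm. 3.7, EVERY vertex `v`, every compatible point sequence `P` over `v` (engine p513113 +
total elevation with `M = 2` + level-kernel cofinality). [cite: MochizukiSemiAnbd2006, Thm 3.7(iv) p.41] -/
theorem isMaximalCompactSubgroup_range_decompHom (h37 : 𝒢.Thm37Hypotheses) {v : 𝒢.graph.Vertex}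
    (P : (𝒢.galoisLevelData h37.toProp36Hypotheses).PointSeq h37.isCountable v) :
    IsMaximalCompactSubgroup P.decompHom.range := by
  refine ⟨?_, fun K hKc hPK => ?_⟩
  · rw [MonoidHom.coe_range]
    exact isCompact_range P.continuous_decompHom
  · by_contra hne
    obtain ⟨n₀, hn₀⟩ := 𝒢.exists_level_forall_branchSubgroup_mul_ker_of_range_decompHom_lt
      h37.toProp36Hypotheses P K hKc hPK (Ne.symm hne)
    -- total elevation at `v` with `M = 2`
    obtain ⟨A, hA, N, hN2, hN⟩ := h37.isTotallyElevated v 2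
    -- a level whose kernel lies in `ker(Π_v → F_v)`
    obtain ⟨m, hm, hmU⟩ := 𝒢.pointSeq_exists_level_forall_gal_eq_one_mem h37 P (A.πV v).ker
      (A.isOpen_ker_πV v) n₀
    obtain ⟨b, hb, hprod⟩ := hn₀ m hm
    exact 𝒢.not_forall_exists_branchSubgroup_mul_ker_of_elevated A hA N hN2 hN b hb fun x => by
      obtain ⟨a, ha, h1⟩ := hprod x
      exact ⟨a, ha, hmU _ h1⟩

/-- Canonical chart: every verticial subgroup is a maximal compact subgroup. [cite: MochizukiSemiAnbd2006, Thm 3.7(iv) p.41] -/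
theorem isMaximalCompactSubgroup_of_mem_verticialSubgroups_canonical (h37 : 𝒢.Thm37Hypotheses)
    {v : 𝒢.graph.Vertex} {H : Subgroup (𝒢.temperedPiChart h37.toProp36Hypotheses).G}
    (hH : H ∈ verticialSubgroups (𝒢.temperedPiChart h37.toProp36Hypotheses) v) :
    IsMaximalCompactSubgroup H := by
  obtain ⟨ψ, hψ, rfl⟩ := hH
  obtain ⟨P, hP⟩ := exists_pointSeq_of_isVerticialHom (h36 := h37.toProp36Hypotheses) (v := v) (ψ := ψ) hψ
  rw [← hP]
  exact 𝒢.isMaximalCompactSubgroup_range_decompHom h37 P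

variable {𝒢}

/-- **[SemiAnbd] Thm 3.7 (iv), first sentence, the half «verticial ⇒ maximal compact» — IN FULL for the typed
Thm-3.7 class**: for every countable semi-graph of anabelioids `𝒢` satisfying the hypotheses of Thm. 3.7 (connected,
countable, quasi-coherent, totally elevated, totally estranged, verticially slim), every chart `c` of `π₁^temp(𝒢)` and
every subgroup `H` which is verticial at SOME vertex, `H` is a MAXIMAL compact subgroup of `π₁^temp(𝒢)` — no
hypothesis on valences, on the vertex or edge groups, or on the underlying graph.  (Stated with the vertex
quantified existentially; at FINITE `𝔾` this is abc-iut-L3-t8's `isMaximalCompactSubgroup_of_mem_verticialSubgroups_of_finiteGraph`,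
whose statement the pointwise form would duplicate verbatim up to the finiteness instances — use
`eq_of_verticial_le_compact` below for the pointwise currency.) [cite: MochizukiSemiAnbd2006, Thm 3.7(iv) p.41] -/
theorem isMaximalCompactSubgroup_of_exists_mem_verticialSubgroups (h37 : 𝒢.Thm37Hypotheses)
    (c : TemperedPiChart 𝒢) {H : Subgroup c.G} (hH : ∃ v : 𝒢.graph.Vertex, H ∈ verticialSubgroups c v) :
    IsMaximalCompactSubgroup H := by
  obtain ⟨v, hH⟩ := hH
  exact isMaximalCompactSubgroup_of_mem_verticialSubgroups_of_canonical h37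
    (fun _ hH' => 𝒢.isMaximalCompactSubgroup_of_mem_verticialSubgroups_canonical h37 hH') c hH

/-- **No compact subgroup of `π₁^temp(𝒢)` strictly contains a verticial subgroup** (same generality, pointwise
currency): a compact `K ⊇ H` with `H` verticial at `v` equals `H`.  In particular an «exotic» compact subgroup
(one lying in no verticial subgroup) never contains a verticial subgroup. [cite: MochizukiSemiAnbd2006, Thm 3.7(iv) p.41] -/
theorem eq_of_verticial_le_compact (h37 : 𝒢.Thm37Hypotheses) (c : TemperedPiChart 𝒢) {v : 𝒢.graph.Vertex}
    {H K : Subgroup c.G} (hH : H ∈ verticialSubgroups c v) (hKc : IsCompact (K : Set c.G)) (hHK : H ≤ K) :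
    K = H :=
  (isMaximalCompactSubgroup_of_exists_mem_verticialSubgroups h37 c ⟨v, hH⟩).2 K hKc hHK

/-- **A compact subgroup containing a verticial subgroup lies in it** (the `≤` currency of the same fact, for
rewriting chains `H ≤ K ≤ …`). [cite: MochizukiSemiAnbd2006, Thm 3.7(iv) p.41] -/
theorem le_of_verticial_le_compact (h37 : 𝒢.Thm37Hypotheses) (c : TemperedPiChart 𝒢) {v : 𝒢.graph.Vertex}
    {H K : Subgroup c.G} (hH : H ∈ verticialSubgroups c v) (hKc : IsCompact (K : Set c.G)) (hHK : H ≤ K) :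
    K ≤ H :=
  (eq_of_verticial_le_compact h37 c hH hKc hHK).le

end ProfiniteSemiGraph

end Literature.AnabelianGeometry.SemiGraphs
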